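import Mathlib
import Summits.CriticalPhenomena.CardyFormulaZ2.Theorems.CardySelfRefinementDefs
import Summits.CriticalPhenomena.CardyFormulaZ2.Theorems.CardySelfRefinementRussoDriftModel
import Summits.CriticalPhenomena.CardyFormulaZ2.Theorems.CardySelfRefinementTrivialSectorRateStubFourArmAboveOneSecondMomentTail
import Summits.CriticalPhenomena.CardyFormulaZ2.Theorems.CardySelfRefinementTrivialSectorRateStubFourArmAboveOneTwoArmsLocality
import Summits.CriticalPhenomena.CardyFormulaZ2.Theorems.CardySelfRefinementTrivialSectorRateStubFourArmAboveOneCircuits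
import Literature.Probability.Percolation.CrossingClusterSecondMoment
import Literature.Probability.Percolation.CrossingClusterBlockEstimate
import Literature.Probability.Percolation.SelfRefinementMeasure
import HarnessLib

/-!
# Helper (M2) of stub `stub_fourArmAboveOne`, line `far-field-is-a-quarter-turn`
(crux `TrivialSectorRate`, stmt-CriticalPhenomena-10266): the CROSSING-CLUSTER SECOND MOMENT
`E[Z²] ≤ 3` for `M_k(γ s)`, uniformly along an RSW path

van den Berg–Nolin's (G-EZ-bnd) — the field `X = Z/2`, `E[X²] ≤ 1` of the Garban scheme data `hS`
of the percolation-free reduction `fourArmAboveOneAlong_of_garbanScheme`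
(file `…StubFourArmAboveOneReduction.lean`) — for the dependent model `M_k(γ s)`, `k = 2, 3`, with
constants uniform in the path parameter:

* `real_boxCrossingEvent_le_pow_along` / `exists_ratio_real_boxCrossingEvent_le_half_along` —
  **RSW at a fixed large ratio**: along `PathOK k γ` there are `K₀ ≥ 2`, `N₀ ≥ 1` with
  `M_k(γ s)(boxCrossingEvent N (K₀ N)) ≤ 1/2` for all `s` and `N ≥ N₀` (the open crossing of
  `B(K₀N) ∖ B(N)` meets `J` geometric, `k`-separated annuli, none of which may carry a closed dual
  circuit; these events are independent under `M_k` and each costs `1 - ρ₄` by (M1) `circuitsAlong`: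
  `real_biInter_compl_dualCircuitInAnnulusAt_eq_prod`, file `…StubFourArmAboveOneTwoArmsLocality.lean`);
* `integral_numCrossingClusters_sq_le_of_real_le_half` — `E_{M_k(q)}[Z²] ≤ 3` as soon as the
  annulus is crossed with probability `≤ 1/2` (`k ≤ 3`): `Z² = Σ_{t<Z} (2t+1)`, the coin-space BK
  tail bound `M_k(Z ≥ t) ≤ M_k(A)^t` (`M_real_setOf_le_numCrossingClusters_le_pow`, file
  `…StubFourArmAboveOneSecondMomentTail.lean`) and `Σ (2t+1) 2^{-(t+1)} ≤ 3`;
* `exists_integral_numCrossingClusters_sq_le_along` (registered helper) — **along `PathOK k γ`,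
  `k = 2, 3`: `∃ K₀ ≥ 2, N₀ ≥ 1, ∀ s, ∀ N ≥ N₀, ∫ Z(ω; N, K₀N)² dM_k(γ s) ≤ 3`.**

References: J. van den Berg, P. Nolin, Progr. Probab. 77 (2020), §3 (eq:upper_bd_C), §5.2
(G-EZ-bnd); G. Grimmett, *Percolation* (1999), §11.7–11.8.

Target file:
`Summits/CriticalPhenomena/CardyFormulaZ2/Theorems/CardySelfRefinementTrivialSectorRateStubFourArmAboveOneSecondMoment.lean`.
-/

noncomputable section

namespace Summit.CriticalPhenomena.CardyFormulaZ2.Theorems.CardySelfRefinement.FarField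

open Set MeasureTheory ProbabilityTheory SimpleGraph
open Literature.Probability.LatticeModels Literature.Probability.Percolation
open Literature.Probability.Percolation.QuadCrossing
open Summit.CriticalPhenomena.CardyFormulaZ2.Theses.CardySelfRefinement

/-! ### RSW: the annulus `B(K₀N) ∖ B(N)` is crossed with probability at most `q^J` -/

/-- **A box crossing meets every intermediate annulus.**  For radii `N + 1 ≤ aᵢ`, `1 ≤ aᵢ ≤ bᵢ`,
`bᵢ + 1 ≤ R` (`i ∈ s`):
`M_k(boxCrossingEvent N R) ≤ M_k(⋂ᵢ (dualCircuitInAnnulusAt (-1) aᵢ bᵢ)ᶜ)` — the open lattice walk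
from `B(N)` to `‖·‖_∞ = R` is incompatible with a closed dual circuit of each dual annulus
(`not_mem_dualCircuitInAnnulusAt_of_openWalk`; `M_k` is carried by lattice configurations). -/
theorem real_boxCrossingEvent_le_real_biInter (k : ℕ) (ρ c₀ : ℝ) {N R : ℕ} (hNR : N ≤ R) (s : Finset ℕ)
    (a b : ℕ → ℕ) (h : ∀ i ∈ s, 1 ≤ a i ∧ N + 1 ≤ a i ∧ a i ≤ b i ∧ b i + 1 ≤ R) :
    (M k ρ c₀).real (boxCrossingEvent N R) ≤
      (M k ρ c₀).real (⋂ i ∈ s, (dualCircuitInAnnulusAt (-1) (a i) (b i))ᶜ) := by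
  refine ENNReal.toReal_mono (measure_ne_top _ _) (measure_mono_ae ?_)
  have hae : ∀ᵐ ω ∂(M k ρ c₀), ω ⊆ (zdGraph 2).edgeSet := selfRefinementMeasure_ae_subset_edgeSet k ρ c₀
  filter_upwards [hae] with ω hω hA
  obtain ⟨x, hx, y, hy, hr⟩ := (hA : ω ∈ boxCrossingEvent N R)
  obtain ⟨p, -, hp⟩ := exists_walk_of_boxOpenGraph_reachable hω (box_mono 2 hNR hx) hr
  refine Set.mem_iInter₂.2 fun i hi => ?_
  obtain ⟨h1, h2, h3, h4⟩ := h i hi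
  refine not_mem_dualCircuitInAnnulusAt_of_openWalk h1 h3 hω p hp ?_ ?_
  · rw [show x - (-1 : Site 2) - 1 = x by simp]
    exact box_mono 2 (by omega) hx
  · rw [show y - (-1 : Site 2) - 1 = y by simp]
    intro hy'
    rw [siteSphere, Finset.mem_sdiff] at hy
    exact hy.2 (box_mono 2 (by omega) hy')

/-- **Geometric annuli: `M_k(boxCrossingEvent N R) ≤ q^J`.**  If every thin annulus `c' + A_{a,b}`
with `a₀ ≤ a < b`, `2b ≤ 4(b - a)` carries a closed dual circuit with `M_k(ρ,c₀)`-probability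
`≥ 1 - q`, then for `N + 1 ≥ max(a₀, 2)` and `J` annuli `(-1) + A_{4ⁱ(N+1), 2·4ⁱ(N+1)}`, `i < J`,
inside radius `R - 1`, the crossing from `B(N)` to `‖·‖_∞ = R` has probability at most `q ^ J`
(`0 < k ≤ 3` makes consecutive annuli `k`-separated; independence
`real_biInter_compl_dualCircuitInAnnulusAt_eq_prod`). -/
theorem real_boxCrossingEvent_le_pow {k : ℕ} (hk0 : 0 < k) (hk3 : k ≤ 3) (ρ c₀ : ℝ) {q : ℝ}
    {a₀ : ℕ} (hcirc : ∀ (c' : Site 2) (a b : ℕ), a₀ ≤ a → a < b → 2 * b ≤ 4 * (b - a) →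
      1 - q ≤ (M k ρ c₀).real (dualCircuitInAnnulusAt c' a b))
    {N R J : ℕ} (hN0 : a₀ ≤ N + 1) (hN1 : 1 ≤ N) (hNR : N ≤ R)
    (hJ : ∀ i < J, 2 * (4 ^ i * (N + 1)) + 1 ≤ R) :
    (M k ρ c₀).real (boxCrossingEvent N R) ≤ q ^ J := by
  haveI := isProbabilityMeasure_M k ρ c₀
  have hpow : ∀ i : ℕ, N + 1 ≤ 4 ^ i * (N + 1) := fun i =>
    Nat.le_mul_of_pos_left (N + 1) (Nat.one_le_pow _ _ (by norm_num))
  have hgeom : ∀ i ∈ Finset.range J, 1 ≤ 4 ^ i * (N + 1) ∧ N + 1 ≤ 4 ^ i * (N + 1) ∧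
      4 ^ i * (N + 1) ≤ 2 * (4 ^ i * (N + 1)) ∧ 2 * (4 ^ i * (N + 1)) + 1 ≤ R := by
    intro i hi
    have h2 := hpow i
    have h3 := hJ i (Finset.mem_range.1 hi)
    omega
  have hfar : ∀ i ∈ Finset.range J, ∀ j ∈ Finset.range J, i < j →
      2 * (4 ^ i * (N + 1)) + k ≤ 4 ^ j * (N + 1) := by
    intro i _ j _ hij
    have h1 : 4 ^ (i + 1) ≤ 4 ^ j := Nat.pow_le_pow_right (by norm_num) hij
    have h2 : 4 ^ (i + 1) * (N + 1) ≤ 4 ^ j * (N + 1) := Nat.mul_le_mul_right (N + 1) h1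
    have h3 : 4 ^ (i + 1) * (N + 1) = 4 * (4 ^ i * (N + 1)) := by ring
    have h4 := hpow i
    omega
  have hq : ∀ i ∈ Finset.range J,
      1 - (M k ρ c₀).real (dualCircuitInAnnulusAt (-1) (4 ^ i * (N + 1)) (2 * (4 ^ i * (N + 1)))) ≤ q := by
    intro i _
    have h4 := hpow i
    have := hcirc (-1) (4 ^ i * (N + 1)) (2 * (4 ^ i * (N + 1))) (by omega) (by omega) (by omega)
    linarith
  calc (M k ρ c₀).real (boxCrossingEvent N R)
      ≤ (M k ρ c₀).real (⋂ i ∈ Finset.range J,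
          (dualCircuitInAnnulusAt (-1) (4 ^ i * (N + 1)) (2 * (4 ^ i * (N + 1))))ᶜ) :=
        real_boxCrossingEvent_le_real_biInter k ρ c₀ hNR (Finset.range J) (fun i => 4 ^ i * (N + 1))
          (fun i => 2 * (4 ^ i * (N + 1))) hgeom
    _ = ∏ i ∈ Finset.range J,
          (1 - (M k ρ c₀).real (dualCircuitInAnnulusAt (-1) (4 ^ i * (N + 1)) (2 * (4 ^ i * (N + 1))))) :=
        real_biInter_compl_dualCircuitInAnnulusAt_eq_prod hk0 ρ c₀ (-1) (Finset.range J)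
          (fun i => 4 ^ i * (N + 1)) (fun i => 2 * (4 ^ i * (N + 1))) hfar
    _ ≤ ∏ _i ∈ Finset.range J, q :=
        Finset.prod_le_prod (fun i _ => sub_nonneg.2 measureReal_le_one) hq
    _ = q ^ J := by rw [Finset.prod_const, Finset.card_range]

/-- **RSW at a fixed large ratio along the path** (registered-helper input): for `PathOK k γ`,
`k = 2, 3`, there are `K₀ ≥ 2` and `N₀ ≥ 1` with `M_k(γ s)(boxCrossingEvent N (K₀ N)) ≤ 1/2` for
every path parameter `s` and every `N ≥ N₀` (dual circuits in `J` separated geometric annuli by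
(M1) `circuitsAlong` at aspect ratio `4`, with `(1 - ρ₄)^J ≤ 1/2`, `K₀ = 4^{J+1}`). -/
theorem exists_ratio_real_boxCrossingEvent_le_half_along {k : ℕ} (hk : k = 2 ∨ k = 3)
    {γ : unitInterval → ℝ × ℝ} (hγ : PathOK k γ) :
    ∃ K₀ N₀ : ℕ, 2 ≤ K₀ ∧ 1 ≤ N₀ ∧ ∀ (s : unitInterval) (N : ℕ), N₀ ≤ N →
      (M k (γ s).1 (γ s).2).real (boxCrossingEvent N (K₀ * N)) ≤ 1 / 2 := by
  have hk0 : 0 < k := by rcases hk with rfl | rfl <;> norm_num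
  have hk3 : k ≤ 3 := by rcases hk with rfl | rfl <;> norm_num
  obtain ⟨ρs, hρs, a₀, hcirc⟩ := circuitsAlong hk hγ (K := 4) (by norm_num)
  set q : ℝ := max (1 - ρs) 0 with hq
  have hq0 : 0 ≤ q := le_max_right _ _
  have hq1 : q < 1 := max_lt (by linarith) (by norm_num)
  obtain ⟨J, hJ⟩ := exists_pow_lt_of_lt_one (by norm_num : (0 : ℝ) < 1 / 2) hq1
  refine ⟨4 ^ (J + 1), max a₀ 1, ?_, le_max_right _ _, fun s N hN => ?_⟩
  · calc 2 ≤ 4 := by norm_num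
      _ = 4 ^ 1 := by norm_num
      _ ≤ 4 ^ (J + 1) := Nat.pow_le_pow_right (by norm_num) (by omega)
  have hN1 : 1 ≤ N := (le_max_right _ _).trans hN
  have hNa : a₀ ≤ N + 1 := ((le_max_left _ _).trans hN).trans (Nat.le_succ _)
  have hQ : 1 ≤ 4 ^ J := Nat.one_le_pow _ _ (by norm_num)
  have hNR : N ≤ 4 ^ (J + 1) * N := Nat.le_mul_of_pos_left N (by positivity)
  have hJR : ∀ i < J, 2 * (4 ^ i * (N + 1)) + 1 ≤ 4 ^ (J + 1) * N := by
    intro i hi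
    have h1 : 4 ^ (i + 1) ≤ 4 ^ J := Nat.pow_le_pow_right (by norm_num) hi
    have h3 : 4 ^ (i + 1) = 4 * 4 ^ i := by ring
    have h4 : 4 ^ (J + 1) = 4 * 4 ^ J := by ring
    have hP : 1 ≤ 4 ^ i := Nat.one_le_pow _ _ (by norm_num)
    rw [h3] at h1
    rw [h4]
    nlinarith
  have hle := real_boxCrossingEvent_le_pow hk0 hk3 (γ s).1 (γ s).2 (q := q) (a₀ := a₀)
    (fun c' a b h1 h2 h3 => by
      have := (hcirc s c' a b h1 h2 h3).2
      linarith [le_max_left (1 - ρs) (0 : ℝ)])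
    hNa hN1 hNR hJR
  exact hle.trans hJ.le

/-! ### `E[Z²] ≤ 3` -/

/-- **`E_{M_k(q)}[Z²] ≤ 3` whenever the annulus `B(R) ∖ B(N)` is crossed with `M_k(q)`-probability
at most `1/2`** (`0 < k ≤ 3`): `Z² = Σ_{t<Z} (2t+1)`, the coin-space BK tail bound
`M_k(Z ≥ t) ≤ M_k(A)^t ≤ 2^{-t}` (`M_real_setOf_le_numCrossingClusters_le_pow`) and
`Σ_t (2t+1) 2^{-(t+1)} ≤ 3` (the tree's `integral_numCrossingClusters_sq_le`, run for `M_k`). -/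
theorem integral_numCrossingClusters_sq_le_of_real_le_half {k : ℕ} (hk0 : 0 < k) (hk3 : k ≤ 3)
    (q : ℝ × ℝ) {N R : ℕ} (hA : (M k q.1 q.2).real (boxCrossingEvent N R) ≤ 1 / 2) :
    ∫ ω, (numCrossingClusters ω N R : ℝ) ^ 2 ∂(M k q.1 q.2) ≤ 3 := by
  haveI := isProbabilityMeasure_M k q.1 q.2
  set K : ℕ := (box 2 N).card with hK
  have hpt : ∀ ω, (numCrossingClusters ω N R : ℝ) ^ 2 =
      ∑ t ∈ Finset.range K, {ω | t + 1 ≤ numCrossingClusters ω N R}.indicator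
        (fun _ => (2 * (t : ℝ) + 1)) ω := by
    intro ω
    rw [sq_eq_sum_indicator (numCrossingClusters_le_card ω N R)]
    refine Finset.sum_congr rfl fun t _ => ?_
    simp only [Set.indicator_apply, Set.mem_setOf_eq]
  simp_rw [hpt]
  have hmeas : ∀ t, MeasurableSet {ω | t + 1 ≤ numCrossingClusters ω N R} := fun t =>
    measurableSet_setOf_numCrossingClusters N R (t + 1 ≤ ·)
  rw [integral_finsetSum _ fun t _ => (integrable_const _).indicator (hmeas t)]
  calc ∑ t ∈ Finset.range K, ∫ ω, {ω | t + 1 ≤ numCrossingClusters ω N R}.indicator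
          (fun _ => (2 * (t : ℝ) + 1)) ω ∂(M k q.1 q.2)
      = ∑ t ∈ Finset.range K, (2 * (t : ℝ) + 1) * (M k q.1 q.2).real {ω | t + 1 ≤ numCrossingClusters ω N R} := by
        refine Finset.sum_congr rfl fun t _ => ?_
        rw [integral_indicator_const _ (hmeas t), smul_eq_mul, mul_comm]
    _ ≤ ∑ t ∈ Finset.range K, (2 * (t : ℝ) + 1) * (1 / 2) ^ (t + 1) :=
        Finset.sum_le_sum fun t _ => mul_le_mul_of_nonneg_left
          ((M_real_setOf_le_numCrossingClusters_le_pow hk0 hk3 q N R (t + 1)).trans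
            (pow_le_pow_left₀ measureReal_nonneg hA (t + 1))) (by positivity)
    _ = 3 - (2 * K + 3) * (1 / 2) ^ K := sum_range_two_mul_add_one_mul_half_pow K
    _ ≤ 3 := by
        have : (0 : ℝ) ≤ (2 * K + 3) * (1 / 2) ^ K := by positivity
        linarith

/-- **(M2) The crossing-cluster second moment along an RSW path** (registered helper of the stub
`stub_fourArmAboveOne`; van den Berg–Nolin's (G-EZ-bnd) `E[Z²] ≤ c̄²` for the dependent model):
for `PathOK k γ`, `k = 2, 3`, there are a ratio `K₀ ≥ 2` and a threshold `N₀ ≥ 1` such that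
`∫ Z(ω; N, K₀ N)² dM_k(γ s) ≤ 3` for every path parameter `s` and every `N ≥ N₀`, where
`Z = numCrossingClusters ω N (K₀ N)` is the number of open clusters of `B(K₀N)` joining `B(N)` to
`‖·‖_∞ = K₀ N` — so that `X = Z/2` satisfies the field `E[X²] ≤ 1` of the Garban scheme data,
uniformly in `s`. -/
theorem exists_integral_numCrossingClusters_sq_le_along {k : ℕ} (hk : k = 2 ∨ k = 3)
    {γ : unitInterval → ℝ × ℝ} (hγ : PathOK k γ) :
    ∃ K₀ N₀ : ℕ, 2 ≤ K₀ ∧ 1 ≤ N₀ ∧ ∀ (s : unitInterval) (N : ℕ), N₀ ≤ N →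
      ∫ ω, (numCrossingClusters ω N (K₀ * N) : ℝ) ^ 2 ∂(M k (γ s).1 (γ s).2) ≤ 3 := by
  have hk0 : 0 < k := by rcases hk with rfl | rfl <;> norm_num
  have hk3 : k ≤ 3 := by rcases hk with rfl | rfl <;> norm_num
  obtain ⟨K₀, N₀, hK₀, hN₀, h⟩ := exists_ratio_real_boxCrossingEvent_le_half_along hk hγ
  exact ⟨K₀, N₀, hK₀, hN₀, fun s N hN =>
    integral_numCrossingClusters_sq_le_of_real_le_half hk0 hk3 (γ s) (h s N hN)⟩

end Summit.CriticalPhenomena.CardyFormulaZ2.Theorems.CardySelfRefinement.FarField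

end
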